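import Summits.SmoothPoincare4.SmoothPoincare4.Theorems.ConvexBisectionAcyclicBisectionExistsDualLoop
import Summits.SmoothPoincare4.SmoothPoincare4.Theorems.ConvexBisectionAcyclicBisectionExistsCrossingRegularLevel
import HarnessLib

/-!
# A dual loop: non-zero crossing number with a smooth page loop forces a loop crossing once
(wave 6, brick G7-2 of the repair lemma N3b′ "shadows of charted embedded page curves are
primitive or zero" for node N3b `node_STembed` of stub `stub_STgeo` = N3 of NF4, line
`modp-braid-orbits`, crux `ConvexBisection.AcyclicBisectionExists`, item stmt-SmoothPoincare4-10508;
registered sub-goal `helper_exists_dual_loop`)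

Let `φ` be a positively oriented smooth annulus chart of `page g c` (the six hypotheses of node
N1a, the core curve being irrelevant) and `b` a loop of the page presented as the core
`b (e^{2πiu}) = ψ (u, 0)` of a smooth `1`-periodic page map `ψ`.  **If `crossingNumber φ b ≠ 0`,
some loop `L` of the page has `crossingNumber φ L = 1`** (`exists_loop_crossingNumber_eq_one_of_ne_zero`).

Proof (Farb–Margalit, *Primer*, §6.1, the dual curve of a non-separating curve, made
combinatorial): a regular level `k` of `φ` for `b` (`exists_regular_level`, X7-2) has finitely many
transversal solutions `S ⊂ (0, 1)` whose signs add up to `crossingNumber φ b ≠ 0`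
(`crossingNumber_eq_sum_sign`, X7-1b); a cyclic `±1`-sequence with non-zero sum has two cyclically
adjacent EQUAL entries (§1, `exists_adjacent_eq_of_sum_ne_zero`: otherwise the signs alternate, the
number of solutions is even and the sum vanishes); between two such consecutive solutions the loop
runs from one side of the level circle to the other without meeting it (§2, one-sided
neighbourhoods of transversal solutions), and the surgery loop of G7-1
(`exists_loop_crossingNumber_eq_one`) crosses the chart exactly once.

Everything is proved; no definitions, no named facts, no `sorry`.  References: B. Farb,
D. Margalit, *A primer on mapping class groups* (2012), §6.1 [FarbMargalit2012]; W. Fulton,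
*Algebraic Topology: A First Course* (1995), §3 [Fulton1995].
-/

noncomputable section

set_option linter.dupNamespace false

open scoped Manifold ContDiff Topology Real
open Set Function Metric Filter
open Literature.Topology.FourManifolds Literature.Topology.FourManifolds.LefschetzBase

namespace Summit.SmoothPoincare4.SmoothPoincare4.Theorems.AcyclicBisectionExists.ModpBraidOrbits

variable {g : ℕ} {c : ℂ} {φ ψ : ℝ × ℝ → Base g} {b : sphere (0 : EuclideanSpace ℝ (Fin 2)) 1 → Base g}

/-! ## §1 Combinatorics of cyclic sign sequences -/

/-- An alternating sum of an even number of equal terms vanishes. [folklore] -/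
theorem sum_range_neg_one_pow_mul_eq_zero (m : ℕ) (x : ℤ) :
    ∑ i ∈ Finset.range (2 * m), (-1) ^ i * x = 0 := by
  induction m with
  | zero => simp
  | succ m ih =>
    rw [show 2 * (m + 1) = 2 * m + 1 + 1 by ring, Finset.sum_range_succ, Finset.sum_range_succ, ih,
      pow_succ]
    ring

/-- **A cyclic `±1`-sequence with non-zero sum has two cyclically adjacent equal entries**: if
`σ 0, …, σ N ∈ {±1}` with `σ N = σ 0` (cyclic closure) and `Σ_{i<N} σ i ≠ 0`, then
`σ i = σ (i+1)` for some `i < N` (otherwise the signs alternate, `N` is even and the sum is `0`).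
[folklore] -/
theorem exists_adjacent_eq_of_sum_ne_zero {σ : ℕ → ℤ} {N : ℕ} (hσ : ∀ i ≤ N, σ i = 1 ∨ σ i = -1)
    (hwrap : σ N = σ 0) (hsum : ∑ i ∈ Finset.range N, σ i ≠ 0) : ∃ i < N, σ i = σ (i + 1) := by
  by_contra h
  push Not at h
  have hflip : ∀ i < N, σ (i + 1) = -σ i := by
    intro i hi
    have hne := h i hi
    rcases hσ i hi.le with h1 | h1 <;> rcases hσ (i + 1) (by omega) with h2 | h2 <;> omega
  have halt : ∀ i ≤ N, σ i = (-1) ^ i * σ 0 := by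
    intro i hi
    induction i with
    | zero => simp
    | succ j ih => rw [hflip j (by omega), ih (by omega), pow_succ]; ring
  have h0 : σ 0 ≠ 0 := by rcases hσ 0 (Nat.zero_le _) with h1 | h1 <;> rw [h1] <;> norm_num
  have hev : Even N := by
    have h1 := halt N le_rfl
    rw [hwrap] at h1
    have h2 : ((-1 : ℤ) ^ N - 1) * σ 0 = 0 := by linear_combination -h1
    rcases mul_eq_zero.1 h2 with h3 | h3
    · have h4 : (-1 : ℤ) ^ N = 1 := by linear_combination h3
      exact (neg_one_pow_eq_one_iff_even (by norm_num : (-1 : ℤ) ≠ 1)).1 h4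
    · exact absurd h3 h0
  obtain ⟨m, hm⟩ := hev
  apply hsum
  rw [Finset.sum_congr rfl fun i hi => halt i (Finset.mem_range.1 hi).le, hm, ← two_mul]
  exact sum_range_neg_one_pow_mul_eq_zero m (σ 0)

/-- Two `±1`-valued indicators agree iff their conditions agree. [folklore] -/
theorem ite_pm_one_eq_iff {p q : Prop} [Decidable p] [Decidable q] :
    ((if p then (1 : ℤ) else -1) = if q then (1 : ℤ) else -1) ↔ (p ↔ q) := by
  by_cases hp : p <;> by_cases hq : q <;> simp [hp, hq]

/-! ## §2 One-sided neighbourhoods of a transversal solution -/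

/-- **The two sides of a transversal solution.**  If the page loop `b` meets the level `k` of the
chart `φ` inside the open annulus at the parameter `u`, where `f = height φ ∘ b ∘ e^{2πi·}` is `C¹`
with non-zero derivative, then for all small `ρ' > 0` the points `b (e^{2πi(u ± ρ')})` lie in the
open annulus, on the side `sign f'(u) · (f − k) > 0` after `u` and on the other side before `u`.
[folklore] -/
theorem exists_sides_of_solution (hc : ‖c‖ = 1) (hφc : Continuous φ)
    (hφ1 : ∀ u r, φ (u + 1, r) = φ (u, r)) (hφp : ∀ p, φ p ∈ page g c)
    (hφi : InjOn φ (Ico (0 : ℝ) 1 ×ˢ Ioo (-1 : ℝ) 1)) (hb : Continuous b)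
    (hbc : ∀ θ, b θ ∈ page g c) {f : ℝ → ℝ}
    {u k : ℝ} (huA : b (circlePt u) ∈ φ '' (univ ×ˢ Ioo (-1 : ℝ) 1)) (hfu : f u = k)
    (hC1 : ContDiffAt ℝ 1 f u) (hdu : deriv f u ≠ 0) :
    ∃ ρ > 0, ∀ ρ' ∈ Ioc (0 : ℝ) ρ,
      (b (circlePt (u + ρ')) ∈ φ '' (univ ×ˢ Ioo (-1 : ℝ) 1) ∧
        0 < (if 0 < deriv f u then (1 : ℝ) else -1) * (f (u + ρ') - k)) ∧
      (b (circlePt (u - ρ')) ∈ φ '' (univ ×ˢ Ioo (-1 : ℝ) 1) ∧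
        (if 0 < deriv f u then (1 : ℝ) else -1) * (f (u - ρ') - k) < 0) := by
  obtain ⟨ρ₁, hρ₁, hcont, hsign⟩ := exists_Icc_deriv_sign hC1 hdu
  have hL : Continuous fun t : ℝ => b (circlePt t) := hb.comp continuous_circlePt
  have hUo : IsOpen ((fun t : ℝ => b (circlePt t)) ⁻¹' (φ '' (univ ×ˢ Ioo (-1 : ℝ) 1))) :=
    isOpen_preimage_annulus hc hφc hφ1 hφp hφi hL fun t => hbc _
  obtain ⟨ε, hε, hball⟩ := Metric.mem_nhds_iff.1 (hUo.mem_nhds huA)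
  set ρ := min ρ₁ (ε / 2) with hρ
  have hρ₁' : ρ ≤ ρ₁ := min_le_left _ _
  have hρε : ρ ≤ ε / 2 := min_le_right _ _
  have hρ0 : 0 < ρ := lt_min hρ₁ (by linarith)
  have hsub : Icc (u - ρ) (u + ρ) ⊆ Icc (u - ρ₁) (u + ρ₁) := Icc_subset_Icc (by linarith) (by linarith)
  have hA : ∀ t ∈ Icc (u - ρ) (u + ρ), b (circlePt t) ∈ φ '' (univ ×ˢ Ioo (-1 : ℝ) 1) := by
    intro t ht
    apply hball
    rw [Real.ball_eq_Ioo]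
    exact ⟨by linarith [ht.1], by linarith [ht.2]⟩
  have hcont' : ContinuousOn f (Icc (u - ρ) (u + ρ)) := hcont.mono hsub
  refine ⟨ρ, hρ0, fun ρ' hρ' => ?_⟩
  have hI₁ : u + ρ' ∈ Icc (u - ρ) (u + ρ) := ⟨by linarith [hρ'.1], by linarith [hρ'.2]⟩
  have hI₂ : u - ρ' ∈ Icc (u - ρ) (u + ρ) := ⟨by linarith [hρ'.2], by linarith [hρ'.1]⟩
  have hIu : u ∈ Icc (u - ρ) (u + ρ) := ⟨by linarith, by linarith⟩
  by_cases hpos : 0 < deriv f u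
  · rw [if_pos hpos, one_mul, one_mul]
    have hmono : StrictMonoOn f (Icc (u - ρ) (u + ρ)) :=
      strictMonoOn_of_deriv_pos (convex_Icc _ _) hcont' fun y hy =>
        pos_of_mul_pos_right (hsign y (hsub (interior_subset hy))) hpos.le
    have h1 : f u < f (u + ρ') := hmono hIu hI₁ (by linarith [hρ'.1])
    have h2 : f (u - ρ') < f u := hmono hI₂ hIu (by linarith [hρ'.1])
    rw [hfu] at h1 h2
    exact ⟨⟨hA _ hI₁, by linarith⟩, ⟨hA _ hI₂, by linarith⟩⟩
  · rw [if_neg hpos]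
    have hneg : deriv f u < 0 := lt_of_le_of_ne (not_lt.1 hpos) hdu
    have hanti : StrictAntiOn f (Icc (u - ρ) (u + ρ)) :=
      strictAntiOn_of_deriv_neg (convex_Icc _ _) hcont' fun y hy => by
        nlinarith [hsign y (hsub (interior_subset hy))]
    have h1 : f (u + ρ') < f u := hanti hIu hI₁ (by linarith [hρ'.1])
    have h2 : f u < f (u - ρ') := hanti hI₂ hIu (by linarith [hρ'.1])
    rw [hfu] at h1 h2
    exact ⟨⟨hA _ hI₁, by linarith⟩, ⟨hA _ hI₂, by linarith⟩⟩

/-- **Closing the gap between two consecutive crossings of the same sign.**  If after `u₁` the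
loop is on the side `s (f − k) > 0`, before `u₂ > u₁` on the side `s (f − k) < 0` (`s = ±1`), and
there is no solution of `f = k` inside the open annulus strictly between `u₁` and `u₂`, then some
loop of the page has crossing number `1` with `φ` (by `exists_loop_crossingNumber_eq_one`).
[cite: FarbMargalit2012, §6.1] -/
theorem exists_loop_of_consecutive (hc : ‖c‖ = 1) (hφc : Continuous φ)
    (hφ1 : ∀ u r, φ (u + 1, r) = φ (u, r)) (hφp : ∀ p, φ p ∈ page g c)
    (hφi : InjOn φ (Ico (0 : ℝ) 1 ×ˢ Ioo (-1 : ℝ) 1)) (hb : Continuous b)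
    (hbc : ∀ θ, b θ ∈ page g c) {f : ℝ → ℝ} (hf : ∀ u, f u = height φ (b (circlePt u)))
    {k : ℝ} (hk : k ∈ Ioo (-(1 / 2) : ℝ) (1 / 2)) {u₁ u₂ s : ℝ} (hs : s = 1 ∨ s = -1)
    (h12 : u₁ < u₂)
    (hfree : ∀ τ ∈ Ioo u₁ u₂, b (circlePt τ) ∈ φ '' (univ ×ˢ Ioo (-1 : ℝ) 1) → f τ ≠ k)
    {ρ₁ : ℝ} (hρ₁ : 0 < ρ₁)
    (hright : ∀ ρ' ∈ Ioc (0 : ℝ) ρ₁, b (circlePt (u₁ + ρ')) ∈ φ '' (univ ×ˢ Ioo (-1 : ℝ) 1) ∧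
      0 < s * (f (u₁ + ρ') - k))
    {ρ₂ : ℝ} (hρ₂ : 0 < ρ₂)
    (hleft : ∀ ρ' ∈ Ioc (0 : ℝ) ρ₂, b (circlePt (u₂ - ρ')) ∈ φ '' (univ ×ˢ Ioo (-1 : ℝ) 1) ∧
      s * (f (u₂ - ρ') - k) < 0) :
    ∃ L : sphere (0 : EuclideanSpace ℝ (Fin 2)) 1 → Base g, Continuous L ∧ (∀ θ, L θ ∈ page g c) ∧
      crossingNumber φ L = 1 := by
  set ρ := min (min ρ₁ ρ₂) ((u₂ - u₁) / 4) with hρ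
  have hρ0 : 0 < ρ := lt_min (lt_min hρ₁ hρ₂) (by linarith)
  have hρa : ρ ≤ ρ₁ := (min_le_left _ _).trans (min_le_left _ _)
  have hρb : ρ ≤ ρ₂ := (min_le_left _ _).trans (min_le_right _ _)
  have hρc : ρ ≤ (u₂ - u₁) / 4 := min_le_right _ _
  obtain ⟨hPA, hPs⟩ := hright ρ ⟨hρ0, hρa⟩
  obtain ⟨hQA, hQs⟩ := hleft ρ ⟨hρ0, hρb⟩
  have hPQ : u₁ + ρ ≤ u₂ - ρ := by linarith
  have hfreeI : ∀ τ ∈ Icc (u₁ + ρ) (u₂ - ρ), b (circlePt τ) ∈ φ '' (univ ×ˢ Ioo (-1 : ℝ) 1) →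
      height φ (b (circlePt τ)) ≠ k := fun τ hτ hA => by
    rw [← hf]; exact hfree τ ⟨by linarith [hτ.1], by linarith [hτ.2]⟩ hA
  rcases hs with rfl | rfl
  · -- `s = 1`: high after `u₁`, low before `u₂`
    rw [one_mul] at hPs hQs
    refine exists_loop_crossingNumber_eq_one hc hφc hφ1 hφp hφi hb hbc hk (lo := u₂ - ρ)
      (hi := u₁ + ρ) (fun τ hτ => hfreeI τ (by rwa [uIcc_of_ge hPQ] at hτ)) hQA ?_ hPA ?_
    · rw [← hf]; linarith
    · rw [← hf]; linarith
  · -- `s = -1`: low after `u₁`, high before `u₂`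
    refine exists_loop_crossingNumber_eq_one hc hφc hφ1 hφp hφi hb hbc hk (lo := u₁ + ρ)
      (hi := u₂ - ρ) (fun τ hτ => hfreeI τ (by rwa [uIcc_of_le hPQ] at hτ)) hPA ?_ hQA ?_
    · rw [← hf]; linarith
    · rw [← hf]; linarith

/-! ## §3 The dual loop -/

/-- **Non-zero crossing number with a smooth page loop forces a loop crossing once.**  For a
positively oriented smooth annulus chart `φ` of `page g c` and the core loop `b` of a smooth
`1`-periodic page map `ψ` with `crossingNumber φ b ≠ 0`, some loop `L` of the page has
`crossingNumber φ L = 1`. [cite: FarbMargalit2012, §6.1] -/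
theorem exists_loop_crossingNumber_eq_one_of_ne_zero (hc : ‖c‖ = 1)
    (hφs : ContMDiff 𝓘(ℝ, ℝ × ℝ) (𝓡∂ 4) ∞ φ) (hφ1 : ∀ u r, φ (u + 1, r) = φ (u, r))
    (hφp : ∀ p, φ p ∈ page g c) (hφi : InjOn φ (Ico (0 : ℝ) 1 ×ˢ Ioo (-1 : ℝ) 1))
    (hφo : ∀ u r, r ∈ Ioo (-1 : ℝ) 1 →
      0 < inner ℝ (deriv (fun r' => (φ (u, r')).1) r) (cplxJ (deriv (fun u' => (φ (u', r)).1) u)))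
    (hψs : ContMDiff 𝓘(ℝ, ℝ × ℝ) (𝓡∂ 4) ∞ ψ) (hψ1 : ∀ u r, ψ (u + 1, r) = ψ (u, r))
    (hψb : ∀ u, ψ (u, 0) = b (circlePt u)) (hψp : ∀ p, ψ p ∈ page g c) (hb : Continuous b)
    (hne : crossingNumber φ b ≠ 0) :
    ∃ L : sphere (0 : EuclideanSpace ℝ (Fin 2)) 1 → Base g, Continuous L ∧ (∀ θ, L θ ∈ page g c) ∧
      crossingNumber φ L = 1 := by
  classical
  have hφc : Continuous φ := hφs.continuous
  have hbc : ∀ θ, b θ ∈ page g c := fun θ => by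
    obtain ⟨t, rfl⟩ := circleParam_surjective θ
    show b (circlePt t) ∈ page g c
    rw [← hψb]
    exact hψp _
  -- a regular level `k` with transversal solutions `S ⊂ (0, 1)`
  obtain ⟨k, hk, S, hS, hlev, hreg⟩ :=
    exists_regular_level hc hψs hψ1 hψp hφs hφ1 hφp hφi hφo (ε := 1 / 2) (by norm_num)
  obtain ⟨f, hf⟩ : ∃ f : ℝ → ℝ, ∀ u, f u = height φ (b (circlePt u)) := ⟨_, fun _ => rfl⟩
  have hfψ : (fun u => height φ (ψ (u, 0))) = f := funext fun u => by rw [hψb, hf]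
  have hfb : (fun u => height φ (b (circlePt u))) = f := funext fun u => by rw [hf]
  rw [hfψ] at hreg
  have hlev' : ∀ u ∈ Icc (0 : ℝ) 1,
      (b (circlePt u) ∈ φ '' (univ ×ˢ Ioo (-1 : ℝ) 1) ∧ height φ (b (circlePt u)) = k) ↔ u ∈ S :=
    fun u hu => by rw [← hψb]; exact hlev u hu
  have hSk : ∀ u ∈ S, b (circlePt u) ∈ φ '' (univ ×ˢ Ioo (-1 : ℝ) 1) ∧ f u = k := fun u hu => by
    rw [hf]; exact (hlev' u ⟨(hS u hu).1.le, (hS u hu).2.le⟩).2 hu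
  have hcount := crossingNumber_eq_sum_sign hc hφc hφ1 hφp hφi hb hbc hk S hS hlev' (by
    rw [hfb]; exact hreg)
  rw [hfb] at hcount
  -- periodicity of `f` and of its derivative
  have hper : ∀ u, f (u + 1) = f u := fun u => by rw [hf, hf, circlePt_add_one]
  have hderper : ∀ u, deriv f (u + 1) = deriv f u := fun u => by
    have h := deriv_comp_add_const f 1 u
    rw [show (fun x => f (x + 1)) = f from funext hper] at h
    exact h.symm
  -- the solutions in increasing order `E 0 < ⋯ < E (N-1)`
  set N := S.card with hN
  obtain ⟨E, hE⟩ : ∃ E : ℕ → ℝ, ∀ (i : ℕ) (h : i < N), E i = S.orderEmbOfFin rfl ⟨i, h⟩ :=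
    ⟨fun i => if h : i < N then S.orderEmbOfFin rfl ⟨i, h⟩ else 0, fun i h => dif_pos h⟩
  have hEmem : ∀ i < N, E i ∈ S := fun i hi => by
    rw [hE i hi]; exact S.orderEmbOfFin_mem rfl _
  have hElt : ∀ i j, i < j → j < N → E i < E j := fun i j hij hj => by
    rw [hE i (hij.trans hj), hE j hj]
    exact (S.orderEmbOfFin rfl).strictMono (Fin.mk_lt_mk.2 hij)
  have hEle : ∀ i j, i ≤ j → j < N → E i ≤ E j := fun i j hij hj => by
    rcases hij.lt_or_eq with h | rfl
    · exact (hElt i j h hj).le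
    · exact le_rfl
  have hEsurj : ∀ u ∈ S, ∃ i < N, E i = u := fun u hu => by
    have h : u ∈ Set.range (S.orderEmbOfFin rfl) := by rw [Finset.range_orderEmbOfFin]; exact hu
    obtain ⟨i, hi⟩ := h
    exact ⟨i, i.2, by rw [hE i i.2]; exact hi⟩
  -- the cyclic sign sequence
  obtain ⟨σ, hσ⟩ : ∃ σ : ℕ → ℤ, ∀ i, σ i =
      if i < N then (if 0 < deriv f (E i) then 1 else -1) else (if 0 < deriv f (E 0) then 1 else -1) :=
    ⟨_, fun _ => rfl⟩
  have hσpm : ∀ i ≤ N, σ i = 1 ∨ σ i = -1 := fun i _ => by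
    rw [hσ]; split_ifs <;> simp
  have hwrap : σ N = σ 0 := by
    rw [hσ, hσ, if_neg (lt_irrefl N)]
    split_ifs <;> rfl
  have hsum : ∑ i ∈ Finset.range N, σ i ≠ 0 := by
    rw [Finset.sum_congr rfl fun i hi => by rw [hσ, if_pos (Finset.mem_range.1 hi)],
      sum_range_orderEmbOfFin S (fun u => if 0 < deriv f u then (1 : ℤ) else -1) hE, ← hcount]
    exact hne
  obtain ⟨i, hi, hii⟩ := exists_adjacent_eq_of_sum_ne_zero hσpm hwrap hsum
  -- one-sided neighbourhoods at the solutions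
  have hsides : ∀ u ∈ S, ∃ ρ > 0, ∀ ρ' ∈ Ioc (0 : ℝ) ρ,
      (b (circlePt (u + ρ')) ∈ φ '' (univ ×ˢ Ioo (-1 : ℝ) 1) ∧
        0 < (if 0 < deriv f u then (1 : ℝ) else -1) * (f (u + ρ') - k)) ∧
      (b (circlePt (u - ρ')) ∈ φ '' (univ ×ˢ Ioo (-1 : ℝ) 1) ∧
        (if 0 < deriv f u then (1 : ℝ) else -1) * (f (u - ρ') - k) < 0) := fun u hu =>
    exists_sides_of_solution hc hφc hφ1 hφp hφi hb hbc (hSk u hu).1 (hSk u hu).2 (hreg u hu).1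
      (hreg u hu).2
  have hspm : ∀ u, (if 0 < deriv f u then (1 : ℝ) else -1) = 1 ∨
      (if 0 < deriv f u then (1 : ℝ) else -1) = -1 := fun u => by split_ifs <;> simp
  -- no solution strictly between consecutive solutions, nor after the last one up to `E 0 + 1`
  have hgapI : ∀ j, j + 1 < N → ∀ τ ∈ Ioo (E j) (E (j + 1)),
      b (circlePt τ) ∈ φ '' (univ ×ˢ Ioo (-1 : ℝ) 1) → f τ ≠ k := by
    intro j hj τ hτ hA hfk
    have hτ01 : τ ∈ Icc (0 : ℝ) 1 :=
      ⟨((hS _ (hEmem j (by omega))).1.trans hτ.1).le, (hτ.2.trans (hS _ (hEmem _ hj)).2).le⟩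
    obtain ⟨l, hl, rfl⟩ := hEsurj τ ((hlev' τ hτ01).1 ⟨hA, by rw [← hf]; exact hfk⟩)
    rcases lt_or_ge l (j + 1) with h | h
    · exact absurd (hEle l j (by omega) (by omega)) (not_le.2 hτ.1)
    · exact absurd (hEle (j + 1) l h hl) (not_le.2 hτ.2)
  have hgapW : 0 < N → ∀ τ ∈ Ioo (E (N - 1)) (E 0 + 1),
      b (circlePt τ) ∈ φ '' (univ ×ˢ Ioo (-1 : ℝ) 1) → f τ ≠ k := by
    intro hN0 τ hτ hA hfk
    have h0 := hS _ (hEmem 0 hN0)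
    have hl := hS _ (hEmem (N - 1) (by omega))
    rcases le_or_gt τ 1 with hτ1 | hτ1
    · have hτ01 : τ ∈ Icc (0 : ℝ) 1 := ⟨(hl.1.trans hτ.1).le, hτ1⟩
      obtain ⟨l, hl', rfl⟩ := hEsurj τ ((hlev' τ hτ01).1 ⟨hA, by rw [← hf]; exact hfk⟩)
      exact absurd (hEle l (N - 1) (by omega) (by omega)) (not_le.2 hτ.1)
    · have hτ01 : τ - 1 ∈ Icc (0 : ℝ) 1 := ⟨by linarith, by linarith [hτ.2, h0.2]⟩
      have hA' : b (circlePt (τ - 1)) ∈ φ '' (univ ×ˢ Ioo (-1 : ℝ) 1) := by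
        rwa [← circlePt_add_one, sub_add_cancel]
      have hfk' : f (τ - 1) = k := by rw [← hper, sub_add_cancel]; exact hfk
      obtain ⟨l, hl', hlτ⟩ := hEsurj (τ - 1) ((hlev' (τ - 1) hτ01).1 ⟨hA', by rw [← hf]; exact hfk'⟩)
      have := hEle 0 l (Nat.zero_le _) hl'
      rw [hlτ] at this
      linarith [hτ.2]
  -- the two cases: an inner pair `E i, E (i+1)`, or the wrap-around pair `E (N-1), E 0 + 1`
  rcases lt_or_ge (i + 1) N with hi1 | hi1
  · rw [hσ, hσ, if_pos hi, if_pos hi1, ite_pm_one_eq_iff] at hii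
    obtain ⟨ρ₁, hρ₁, h₁⟩ := hsides _ (hEmem i hi)
    obtain ⟨ρ₂, hρ₂, h₂⟩ := hsides _ (hEmem (i + 1) hi1)
    have hs12 : (if 0 < deriv f (E (i + 1)) then (1 : ℝ) else -1) =
        if 0 < deriv f (E i) then (1 : ℝ) else -1 := by simp only [hii]
    exact exists_loop_of_consecutive hc hφc hφ1 hφp hφi hb hbc hf hk (hspm (E i))
      (hElt i (i + 1) (lt_add_one i) hi1) (hgapI i hi1) hρ₁ (fun ρ' hρ' => (h₁ ρ' hρ').1) hρ₂
      (fun ρ' hρ' => by rw [← hs12]; exact (h₂ ρ' hρ').2)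
  · have hiN : i = N - 1 := by omega
    have hN0 : 0 < N := by omega
    rw [hσ, hσ, if_pos hi, if_neg (show ¬(i + 1 < N) by omega), hiN, ite_pm_one_eq_iff] at hii
    obtain ⟨ρ₁, hρ₁, h₁⟩ := hsides _ (hEmem (N - 1) (by omega))
    obtain ⟨ρ₂, hρ₂, h₂⟩ := hsides _ (hEmem 0 hN0)
    have hs12 : (if 0 < deriv f (E 0) then (1 : ℝ) else -1) =
        if 0 < deriv f (E (N - 1)) then (1 : ℝ) else -1 := by simp only [hii]
    have hlt : E (N - 1) < E 0 + 1 := by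
      linarith [(hS _ (hEmem (N - 1) (by omega))).2, (hS _ (hEmem 0 hN0)).1]
    refine exists_loop_of_consecutive hc hφc hφ1 hφp hφi hb hbc hf hk (hspm (E (N - 1))) hlt
      (hgapW hN0) hρ₁ (fun ρ' hρ' => (h₁ ρ' hρ').1) hρ₂ (fun ρ' hρ' => ?_)
    obtain ⟨hA, hsgn⟩ := (h₂ ρ' hρ').2
    rw [show E 0 + 1 - ρ' = E 0 - ρ' + 1 by ring, circlePt_add_one, hper, ← hs12]
    exact ⟨hA, hsgn⟩

/-! ## §4 The registered form -/

/-- **Sub-goal `helper_exists_dual_loop`** (G7-2, the dual-loop step of the repair lemma N3b′ of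
node N3b of NF4): for a positively oriented smooth annulus chart `φ` of `page g c` and the core
loop `b` of a smooth `1`-periodic page map `ψ` with `crossingNumber φ b ≠ 0`, some page loop has
crossing number `1` with `φ`, in registered form. [cite: FarbMargalit2012, §6.1] -/
theorem helper_exists_dual_loop : ∀ (g : ℕ) (c : ℂ) (_hc : ‖c‖ = 1) (φ ψ : ℝ × ℝ → Literature.Topology.FourManifolds.LefschetzBase.Base g) (b : Metric.sphere (0 : EuclideanSpace ℝ (Fin 2)) 1 → Literature.Topology.FourManifolds.LefschetzBase.Base g), ContMDiff 𝓘(ℝ, ℝ × ℝ) (𝓡∂ 4) ∞ φ → (∀ u r, φ (u + 1, r) = φ (u, r)) → (∀ p, φ p ∈ Literature.Topology.FourManifolds.LefschetzBase.page g c) → Set.InjOn φ (Set.Ico (0 : ℝ) 1 ×ˢ Set.Ioo (-1 : ℝ) 1) → (∀ u r, r ∈ Set.Ioo (-1 : ℝ) 1 → 0 < inner ℝ (deriv (fun r' => (φ (u, r')).1) r) (Literature.Topology.FourManifolds.LefschetzBase.cplxJ (deriv (fun u' => (φ (u', r)).1) u))) → ContMDiff 𝓘(ℝ, ℝ × ℝ)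 (𝓡∂ 4) ∞ ψ → (∀ u r, ψ (u + 1, r) = ψ (u, r)) → (∀ u, ψ (u, 0) = b (Literature.Topology.FourManifolds.circlePt u)) → (∀ p, ψ p ∈ Literature.Topology.FourManifolds.LefschetzBase.page g c) → Continuous b → Summit.SmoothPoincare4.SmoothPoincare4.Theorems.AcyclicBisectionExists.ModpBraidOrbits.crossingNumber φ b ≠ 0 → ∃ L : Metric.sphere (0 : EuclideanSpace ℝ (Fin 2)) 1 → Literature.Topology.FourManifolds.LefschetzBase.Base g, Continuous L ∧ (∀ θ, L θ ∈ Literature.Topology.FourManifolds.LefschetzBase.page g c) ∧ Summit.SmoothPoincare4.SmoothPoincare4.Theorems.AcyclicBisectionExists.ModpBraidOrbits.crossingNumber φ L = 1 :=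
  fun _ _ hc _ _ _ hφs hφ1 hφp hφi hφo hψs hψ1 hψb hψp hb hne =>
    exists_loop_crossingNumber_eq_one_of_ne_zero hc hφs hφ1 hφp hφi hφo hψs hψ1 hψb hψp hb hne

end Summit.SmoothPoincare4.SmoothPoincare4.Theorems.AcyclicBisectionExists.ModpBraidOrbits

end
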